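import Mathlib
import HarnessLib
import Summits.AtomisticToContinuum.Crystallization.Theorems.PricedLinkCensusSoftFourRingsTwoBlocksB

/-!
# Soft four-rings: two slack triangles are impossible (third part)

Support file for `SoftFourRings` (route `PricedLinkCensus`, sub-problem `Crystallization`).
Bond-set level: the data of a block (the conclusion of `slack_block`, without the bond-triangle
counts) is taken as one hypothesis per block.

* `two_blocks_c` : two blocks with `r₁ = c₂` are impossible;
* `no_two_blocks` : two blocks whose apices `r₁`, `r₂` lie in the other triangle are impossible.
-/

namespace Summit.AtomisticToContinuum.Crystallization.Theorems

open Real RealInnerProductSpace Literature.Geometry.DiscreteGeometry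

section Setting

variable {X : Finset (EuclideanSpace ℝ (Fin 3))} {B : Finset (Finset (EuclideanSpace ℝ (Fin 3)))}
  (hB : ∀ T ∈ B, ∃ u ∈ X, ∃ u' ∈ X, u ≠ u' ∧ 1 - (101 / 100 : ℝ) ^ 2 / 2 ≤ ⟪u, u'⟫ ∧ T = {u, u'})
  (hcard : X.card = 12)
  (hdeg : ∀ v ∈ X, ∃ w : Fin 4 → EuclideanSpace ℝ (Fin 3), (∀ k, w k ∈ X) ∧
    Function.Injective w ∧ (∀ k, w k ≠ v) ∧
    (∀ k, ({v, w k} : Finset (EuclideanSpace ℝ (Fin 3))) ∈ B) ∧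
    ∀ y, ({v, y} : Finset (EuclideanSpace ℝ (Fin 3))) ∈ B → ∃ k, y = w k)

include hB hcard hdeg in
/-- Two blocks with `r₁ = c₂` (and `r₂` in the first triangle) are impossible. -/
theorem two_blocks_c {a1 b1 c1 p1 q1 u1 w1 m1 n1 r1 a2 b2 c2 p2 q2 u2 w2 m2 n2 r2 : EuclideanSpace ℝ (Fin 3)}
    (ha1 : a1 ∈ X) (hb1 : b1 ∈ X) (hc1 : c1 ∈ X) (ha2 : a2 ∈ X) (hb2 : b2 ∈ X) (hc2 : c2 ∈ X)
    (h1 : ((p1 ∈ X ∧ q1 ∈ X ∧ u1 ∈ X ∧ w1 ∈ X ∧ m1 ∈ X ∧ n1 ∈ X ∧ r1 ∈ X) ∧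
      (∀ y, ({a1, y} : Finset (EuclideanSpace ℝ (Fin 3))) ∈ B ↔ (y = p1 ∨ y = u1 ∨ y = r1 ∨ y = b1)) ∧
      (∀ y, ({b1, y} : Finset (EuclideanSpace ℝ (Fin 3))) ∈ B ↔ (y = q1 ∨ y = w1 ∨ y = r1 ∨ y = a1)) ∧
      (∀ y, ({c1, y} : Finset (EuclideanSpace ℝ (Fin 3))) ∈ B ↔ (y = p1 ∨ y = n1 ∨ y = m1 ∨ y = q1)) ∧
      (∀ y, ({r1, y} : Finset (EuclideanSpace ℝ (Fin 3))) ∈ B ↔ (y = u1 ∨ y = a1 ∨ y = b1 ∨ y = w1)) ∧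
      (({p1, u1} : Finset (EuclideanSpace ℝ (Fin 3))) ∈ B ∧
        ({u1, r1} : Finset (EuclideanSpace ℝ (Fin 3))) ∈ B ∧
        ({r1, b1} : Finset (EuclideanSpace ℝ (Fin 3))) ∈ B ∧
        ({q1, w1} : Finset (EuclideanSpace ℝ (Fin 3))) ∈ B ∧
        ({w1, r1} : Finset (EuclideanSpace ℝ (Fin 3))) ∈ B ∧
        ({p1, n1} : Finset (EuclideanSpace ℝ (Fin 3))) ∈ B ∧
        ({n1, m1} : Finset (EuclideanSpace ℝ (Fin 3))) ∈ B ∧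
        ({m1, q1} : Finset (EuclideanSpace ℝ (Fin 3))) ∈ B) ∧
      (({p1, r1} : Finset (EuclideanSpace ℝ (Fin 3))) ∉ B ∧
        ({u1, b1} : Finset (EuclideanSpace ℝ (Fin 3))) ∉ B ∧
        ({p1, b1} : Finset (EuclideanSpace ℝ (Fin 3))) ∉ B ∧
        ({q1, r1} : Finset (EuclideanSpace ℝ (Fin 3))) ∉ B ∧
        ({w1, a1} : Finset (EuclideanSpace ℝ (Fin 3))) ∉ B ∧
        ({q1, a1} : Finset (EuclideanSpace ℝ (Fin 3))) ∉ B ∧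
        ({p1, m1} : Finset (EuclideanSpace ℝ (Fin 3))) ∉ B ∧
        ({n1, q1} : Finset (EuclideanSpace ℝ (Fin 3))) ∉ B ∧
        ({p1, q1} : Finset (EuclideanSpace ℝ (Fin 3))) ∉ B ∧
        ({u1, w1} : Finset (EuclideanSpace ℝ (Fin 3))) ∉ B) ∧
      ((p1 ≠ u1 ∧ p1 ≠ r1 ∧ p1 ≠ b1 ∧ u1 ≠ r1 ∧ u1 ≠ b1 ∧ r1 ≠ b1) ∧
        (q1 ≠ w1 ∧ q1 ≠ r1 ∧ q1 ≠ a1 ∧ w1 ≠ r1 ∧ w1 ≠ a1 ∧ r1 ≠ a1) ∧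
        (p1 ≠ n1 ∧ p1 ≠ m1 ∧ p1 ≠ q1 ∧ n1 ≠ m1 ∧ n1 ≠ q1 ∧ m1 ≠ q1) ∧
        (u1 ≠ a1 ∧ u1 ≠ b1 ∧ u1 ≠ w1 ∧ a1 ≠ b1 ∧ a1 ≠ w1 ∧ b1 ≠ w1) ∧ r1 ≠ c1) ∧
      (∀ y, ({p1, y} : Finset (EuclideanSpace ℝ (Fin 3))) ∈ B ↔ (y = a1 ∨ y = u1 ∨ y = c1 ∨ y = n1)) ∧
      (∀ y, ({q1, y} : Finset (EuclideanSpace ℝ (Fin 3))) ∈ B ↔ (y = b1 ∨ y = w1 ∨ y = c1 ∨ y = m1))))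
    (h2 : ((p2 ∈ X ∧ q2 ∈ X ∧ u2 ∈ X ∧ w2 ∈ X ∧ m2 ∈ X ∧ n2 ∈ X ∧ r2 ∈ X) ∧
      (∀ y, ({a2, y} : Finset (EuclideanSpace ℝ (Fin 3))) ∈ B ↔ (y = p2 ∨ y = u2 ∨ y = r2 ∨ y = b2)) ∧
      (∀ y, ({b2, y} : Finset (EuclideanSpace ℝ (Fin 3))) ∈ B ↔ (y = q2 ∨ y = w2 ∨ y = r2 ∨ y = a2)) ∧
      (∀ y, ({c2, y} : Finset (EuclideanSpace ℝ (Fin 3))) ∈ B ↔ (y = p2 ∨ y = n2 ∨ y = m2 ∨ y = q2)) ∧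
      (∀ y, ({r2, y} : Finset (EuclideanSpace ℝ (Fin 3))) ∈ B ↔ (y = u2 ∨ y = a2 ∨ y = b2 ∨ y = w2)) ∧
      (({p2, u2} : Finset (EuclideanSpace ℝ (Fin 3))) ∈ B ∧
        ({u2, r2} : Finset (EuclideanSpace ℝ (Fin 3))) ∈ B ∧
        ({r2, b2} : Finset (EuclideanSpace ℝ (Fin 3))) ∈ B ∧
        ({q2, w2} : Finset (EuclideanSpace ℝ (Fin 3))) ∈ B ∧
        ({w2, r2} : Finset (EuclideanSpace ℝ (Fin 3))) ∈ B ∧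
        ({p2, n2} : Finset (EuclideanSpace ℝ (Fin 3))) ∈ B ∧
        ({n2, m2} : Finset (EuclideanSpace ℝ (Fin 3))) ∈ B ∧
        ({m2, q2} : Finset (EuclideanSpace ℝ (Fin 3))) ∈ B) ∧
      (({p2, r2} : Finset (EuclideanSpace ℝ (Fin 3))) ∉ B ∧
        ({u2, b2} : Finset (EuclideanSpace ℝ (Fin 3))) ∉ B ∧
        ({p2, b2} : Finset (EuclideanSpace ℝ (Fin 3))) ∉ B ∧
        ({q2, r2} : Finset (EuclideanSpace ℝ (Fin 3))) ∉ B ∧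
        ({w2, a2} : Finset (EuclideanSpace ℝ (Fin 3))) ∉ B ∧
        ({q2, a2} : Finset (EuclideanSpace ℝ (Fin 3))) ∉ B ∧
        ({p2, m2} : Finset (EuclideanSpace ℝ (Fin 3))) ∉ B ∧
        ({n2, q2} : Finset (EuclideanSpace ℝ (Fin 3))) ∉ B ∧
        ({p2, q2} : Finset (EuclideanSpace ℝ (Fin 3))) ∉ B ∧
        ({u2, w2} : Finset (EuclideanSpace ℝ (Fin 3))) ∉ B) ∧
      ((p2 ≠ u2 ∧ p2 ≠ r2 ∧ p2 ≠ b2 ∧ u2 ≠ r2 ∧ u2 ≠ b2 ∧ r2 ≠ b2) ∧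
        (q2 ≠ w2 ∧ q2 ≠ r2 ∧ q2 ≠ a2 ∧ w2 ≠ r2 ∧ w2 ≠ a2 ∧ r2 ≠ a2) ∧
        (p2 ≠ n2 ∧ p2 ≠ m2 ∧ p2 ≠ q2 ∧ n2 ≠ m2 ∧ n2 ≠ q2 ∧ m2 ≠ q2) ∧
        (u2 ≠ a2 ∧ u2 ≠ b2 ∧ u2 ≠ w2 ∧ a2 ≠ b2 ∧ a2 ≠ w2 ∧ b2 ≠ w2) ∧ r2 ≠ c2) ∧
      (∀ y, ({p2, y} : Finset (EuclideanSpace ℝ (Fin 3))) ∈ B ↔ (y = a2 ∨ y = u2 ∨ y = c2 ∨ y = n2)) ∧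
      (∀ y, ({q2, y} : Finset (EuclideanSpace ℝ (Fin 3))) ∈ B ↔ (y = b2 ∨ y = w2 ∨ y = c2 ∨ y = m2))))
    {V3 : EuclideanSpace ℝ (Fin 3) → Prop} (hVa1 : V3 a1) (hVb1 : V3 b1) (hVa2 : V3 a2) (hVb2 : V3 b2)
    (hVc2 : V3 c2) (hVp1 : ¬ V3 p1) (hVq1 : ¬ V3 q1)
    (hdisj : ∀ y, (y = a1 ∨ y = b1 ∨ y = c1) → ¬ (y = a2 ∨ y = b2 ∨ y = c2))
    (hac1 : a1 ≠ c1) (hbc1 : b1 ≠ c1) (hac2 : a2 ≠ c2) (hbc2 : b2 ≠ c2)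
    (hr1 : r1 = c2) (hr2 : r2 = a1 ∨ r2 = b1 ∨ r2 = c1) : False := by
  have h1c := h1
  have h2c := h2
  obtain ⟨⟨hp1X, hq1X, hu1X, hw1X, hm1X, hn1X, hr1X⟩, hNa1, hNb1, hNc1, hNr1,
    ⟨hBpu1, hBur1, hBrb1, hBqw1, hBwr1, hBpn1, hBnm1, hBmq1⟩,
    ⟨hBpr1, hBub1, hBpb1, hBqr1, hBwa1, hBqa1, hBpm1, hBnq1, hBpq1, hBuw1⟩,
    ⟨⟨hpu1, hpr1, hpb1, hur1, hub1, hrb1⟩, ⟨hqw1, hqr1, hqa1, hwr1, hwa1, hra1⟩,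
      ⟨hpn1, hpm1, hpq1, hnm1, hnq1, hmq1⟩, ⟨hua1, hub'1, huw1, hab1, haw1, hbw1⟩, hrc1⟩,
    hNp1, hNq1⟩ := h1c
  obtain ⟨⟨hp2X, hq2X, hu2X, hw2X, hm2X, hn2X, hr2X⟩, hNa2, hNb2, hNc2, hNr2,
    ⟨hBpu2, hBur2, hBrb2, hBqw2, hBwr2, hBpn2, hBnm2, hBmq2⟩,
    ⟨hBpr2, hBub2, hBpb2, hBqr2, hBwa2, hBqa2, hBpm2, hBnq2, hBpq2, hBuw2⟩,
    ⟨⟨hpu2, hpr2, hpb2, hur2, hub2, hrb2⟩, ⟨hqw2, hqr2, hqa2, hwr2, hwa2, hra2⟩,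
      ⟨hpn2, hpm2, hpq2, hnm2, hnq2, hmq2⟩, ⟨hua2, hub'2, huw2, hab2, haw2, hbw2⟩, hrc2⟩,
    hNp2, hNq2⟩ := h2c
  subst r1
  have hdisj' : ∀ y, (y = b1 ∨ y = a1 ∨ y = c1) → ¬ (y = a2 ∨ y = b2 ∨ y = c2) := fun y hy =>
    hdisj y (by rcases hy with h | h | h; exacts [Or.inr (Or.inl h), Or.inl h, Or.inr (Or.inr h)])
  -- position at `r₁ = c₂`
  have key1 := fan_paths_eq hB hNc2 hNr1 hBpn2 hBnm2 hBmq2 hBpm2 hBnq2 hBpq2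
    (by rw [Finset.pair_comm]; exact (hNa1 u1).2 (Or.inr (Or.inl rfl)))
    ((hNa1 b1).2 (Or.inr (Or.inr (Or.inr rfl)))) ((hNb1 w1).2 (Or.inr (Or.inl rfl))) hub1 haw1 hab1
  have hu2a2 : ({u2, a2} : Finset (EuclideanSpace ℝ (Fin 3))) ∈ B := by
    rw [Finset.pair_comm]; exact (hNa2 u2).2 (Or.inr (Or.inl rfl))
  have ha2b2 : ({a2, b2} : Finset (EuclideanSpace ℝ (Fin 3))) ∈ B :=
    (hNa2 b2).2 (Or.inr (Or.inr (Or.inr rfl)))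
  have hb2w2 : ({b2, w2} : Finset (EuclideanSpace ℝ (Fin 3))) ∈ B := (hNb2 w2).2 (Or.inr (Or.inl rfl))
  rcases hr2 with hr2 | hr2 | hr2
  · -- `r₂ = a₁`
    subst r2
    rcases fan_paths_eq hB hNa1 hNr2 hBpu1 hBur1 hBrb1 hBpr1 hBub1 hBpb1 hu2a2 ha2b2 hb2w2 hub2
        haw2 hab2 with ⟨-, -, e, -⟩ | ⟨-, e, -, -⟩
    · exact hbc2 e
    · exact hac2 e
  · -- `r₂ = b₁`
    subst r2
    rcases fan_paths_eq hB hNb1 hNr2 hBqw1 hBwr1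
        (by rw [Finset.pair_comm]; exact (hNa1 c2).2 (Or.inr (Or.inr (Or.inl rfl)))) hBqr1 hBwa1
        hBqa1 hu2a2 ha2b2 hb2w2 hub2 haw2 hab2 with ⟨-, -, e, -⟩ | ⟨-, e, -, -⟩
    · exact hbc2 e
    · exact hac2 e
  -- `r₂ = c₁`
  have hNr2' : ∀ y, ({c1, y} : Finset (EuclideanSpace ℝ (Fin 3))) ∈ B ↔
      (y = u2 ∨ y = a2 ∨ y = b2 ∨ y = w2) := hr2 ▸ hNr2
  have key2 := fan_paths_eq hB hNc1 hNr2' hBpn1 hBnm1 hBmq1 hBpm1 hBnq1 hBpq1 hu2a2 ha2b2 hb2w2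
    hub2 haw2 hab2
  rcases key1 with ⟨hu1, hn2, hm2, hw1⟩ | ⟨hu1, hm2, hn2, hw1⟩ <;>
    rcases key2 with ⟨hu2, hn1, hm1, hw2⟩ | ⟨hu2, hm1, hn1, hw2⟩
  · exact two_blocks_cc1 hB hcard hdeg ha1 hb1 hc1 ha2 hb2 hc2 h1 h2 hVa1 hVa2 hVb2 hVc2 hVp1 hVq1
      hdisj hac1 hbc1 hac2 hbc2 rfl hr2 hu1 hn2 hm2 hw1 hu2 hn1 hm1 hw2
  · exact two_blocks_cc2 hB hcard hdeg ha1 hb1 hc1 ha2 hb2 hc2 h1 h2 hVa1 hVa2 hVb2 hVc2 hVp1 hVq1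
      hdisj hac1 hbc1 hac2 hbc2 rfl hr2 hu1 hn2 hm2 hw1 hu2 hm1 hn1 hw2
  · exact two_blocks_cc2 hB hcard hdeg hb1 ha1 hc1 ha2 hb2 hc2 (block_swap h1) h2 hVb1 hVa2 hVb2 hVc2
      hVq1 hVp1 hdisj' hbc1 hac1 hac2 hbc2 rfl hr2 hw1 hn2 hm2 hu1 hu2 hn1 hm1 hw2
  · exact two_blocks_cc1 hB hcard hdeg hb1 ha1 hc1 ha2 hb2 hc2 (block_swap h1) h2 hVb1 hVa2 hVb2 hVc2
      hVq1 hVp1 hdisj' hbc1 hac1 hac2 hbc2 rfl hr2 hw1 hn2 hm2 hu1 hu2 hm1 hn1 hw2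

include hB hcard hdeg in
/-- **No two blocks.**  Two blocks whose apices satisfy `r₁ ∈ {a₂, b₂, c₂}` and
`r₂ ∈ {a₁, b₁, c₁}` are impossible. -/
theorem no_two_blocks {a1 b1 c1 p1 q1 u1 w1 m1 n1 r1 a2 b2 c2 p2 q2 u2 w2 m2 n2 r2 : EuclideanSpace ℝ (Fin 3)}
    (ha1 : a1 ∈ X) (hb1 : b1 ∈ X) (hc1 : c1 ∈ X) (ha2 : a2 ∈ X) (hb2 : b2 ∈ X) (hc2 : c2 ∈ X)
    (h1 : ((p1 ∈ X ∧ q1 ∈ X ∧ u1 ∈ X ∧ w1 ∈ X ∧ m1 ∈ X ∧ n1 ∈ X ∧ r1 ∈ X) ∧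
      (∀ y, ({a1, y} : Finset (EuclideanSpace ℝ (Fin 3))) ∈ B ↔ (y = p1 ∨ y = u1 ∨ y = r1 ∨ y = b1)) ∧
      (∀ y, ({b1, y} : Finset (EuclideanSpace ℝ (Fin 3))) ∈ B ↔ (y = q1 ∨ y = w1 ∨ y = r1 ∨ y = a1)) ∧
      (∀ y, ({c1, y} : Finset (EuclideanSpace ℝ (Fin 3))) ∈ B ↔ (y = p1 ∨ y = n1 ∨ y = m1 ∨ y = q1)) ∧
      (∀ y, ({r1, y} : Finset (EuclideanSpace ℝ (Fin 3))) ∈ B ↔ (y = u1 ∨ y = a1 ∨ y = b1 ∨ y = w1)) ∧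
      (({p1, u1} : Finset (EuclideanSpace ℝ (Fin 3))) ∈ B ∧
        ({u1, r1} : Finset (EuclideanSpace ℝ (Fin 3))) ∈ B ∧
        ({r1, b1} : Finset (EuclideanSpace ℝ (Fin 3))) ∈ B ∧
        ({q1, w1} : Finset (EuclideanSpace ℝ (Fin 3))) ∈ B ∧
        ({w1, r1} : Finset (EuclideanSpace ℝ (Fin 3))) ∈ B ∧
        ({p1, n1} : Finset (EuclideanSpace ℝ (Fin 3))) ∈ B ∧
        ({n1, m1} : Finset (EuclideanSpace ℝ (Fin 3))) ∈ B ∧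
        ({m1, q1} : Finset (EuclideanSpace ℝ (Fin 3))) ∈ B) ∧
      (({p1, r1} : Finset (EuclideanSpace ℝ (Fin 3))) ∉ B ∧
        ({u1, b1} : Finset (EuclideanSpace ℝ (Fin 3))) ∉ B ∧
        ({p1, b1} : Finset (EuclideanSpace ℝ (Fin 3))) ∉ B ∧
        ({q1, r1} : Finset (EuclideanSpace ℝ (Fin 3))) ∉ B ∧
        ({w1, a1} : Finset (EuclideanSpace ℝ (Fin 3))) ∉ B ∧
        ({q1, a1} : Finset (EuclideanSpace ℝ (Fin 3))) ∉ B ∧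
        ({p1, m1} : Finset (EuclideanSpace ℝ (Fin 3))) ∉ B ∧
        ({n1, q1} : Finset (EuclideanSpace ℝ (Fin 3))) ∉ B ∧
        ({p1, q1} : Finset (EuclideanSpace ℝ (Fin 3))) ∉ B ∧
        ({u1, w1} : Finset (EuclideanSpace ℝ (Fin 3))) ∉ B) ∧
      ((p1 ≠ u1 ∧ p1 ≠ r1 ∧ p1 ≠ b1 ∧ u1 ≠ r1 ∧ u1 ≠ b1 ∧ r1 ≠ b1) ∧
        (q1 ≠ w1 ∧ q1 ≠ r1 ∧ q1 ≠ a1 ∧ w1 ≠ r1 ∧ w1 ≠ a1 ∧ r1 ≠ a1) ∧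
        (p1 ≠ n1 ∧ p1 ≠ m1 ∧ p1 ≠ q1 ∧ n1 ≠ m1 ∧ n1 ≠ q1 ∧ m1 ≠ q1) ∧
        (u1 ≠ a1 ∧ u1 ≠ b1 ∧ u1 ≠ w1 ∧ a1 ≠ b1 ∧ a1 ≠ w1 ∧ b1 ≠ w1) ∧ r1 ≠ c1) ∧
      (∀ y, ({p1, y} : Finset (EuclideanSpace ℝ (Fin 3))) ∈ B ↔ (y = a1 ∨ y = u1 ∨ y = c1 ∨ y = n1)) ∧
      (∀ y, ({q1, y} : Finset (EuclideanSpace ℝ (Fin 3))) ∈ B ↔ (y = b1 ∨ y = w1 ∨ y = c1 ∨ y = m1))))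
    (h2 : ((p2 ∈ X ∧ q2 ∈ X ∧ u2 ∈ X ∧ w2 ∈ X ∧ m2 ∈ X ∧ n2 ∈ X ∧ r2 ∈ X) ∧
      (∀ y, ({a2, y} : Finset (EuclideanSpace ℝ (Fin 3))) ∈ B ↔ (y = p2 ∨ y = u2 ∨ y = r2 ∨ y = b2)) ∧
      (∀ y, ({b2, y} : Finset (EuclideanSpace ℝ (Fin 3))) ∈ B ↔ (y = q2 ∨ y = w2 ∨ y = r2 ∨ y = a2)) ∧
      (∀ y, ({c2, y} : Finset (EuclideanSpace ℝ (Fin 3))) ∈ B ↔ (y = p2 ∨ y = n2 ∨ y = m2 ∨ y = q2)) ∧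
      (∀ y, ({r2, y} : Finset (EuclideanSpace ℝ (Fin 3))) ∈ B ↔ (y = u2 ∨ y = a2 ∨ y = b2 ∨ y = w2)) ∧
      (({p2, u2} : Finset (EuclideanSpace ℝ (Fin 3))) ∈ B ∧
        ({u2, r2} : Finset (EuclideanSpace ℝ (Fin 3))) ∈ B ∧
        ({r2, b2} : Finset (EuclideanSpace ℝ (Fin 3))) ∈ B ∧
        ({q2, w2} : Finset (EuclideanSpace ℝ (Fin 3))) ∈ B ∧
        ({w2, r2} : Finset (EuclideanSpace ℝ (Fin 3))) ∈ B ∧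
        ({p2, n2} : Finset (EuclideanSpace ℝ (Fin 3))) ∈ B ∧
        ({n2, m2} : Finset (EuclideanSpace ℝ (Fin 3))) ∈ B ∧
        ({m2, q2} : Finset (EuclideanSpace ℝ (Fin 3))) ∈ B) ∧
      (({p2, r2} : Finset (EuclideanSpace ℝ (Fin 3))) ∉ B ∧
        ({u2, b2} : Finset (EuclideanSpace ℝ (Fin 3))) ∉ B ∧
        ({p2, b2} : Finset (EuclideanSpace ℝ (Fin 3))) ∉ B ∧
        ({q2, r2} : Finset (EuclideanSpace ℝ (Fin 3))) ∉ B ∧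
        ({w2, a2} : Finset (EuclideanSpace ℝ (Fin 3))) ∉ B ∧
        ({q2, a2} : Finset (EuclideanSpace ℝ (Fin 3))) ∉ B ∧
        ({p2, m2} : Finset (EuclideanSpace ℝ (Fin 3))) ∉ B ∧
        ({n2, q2} : Finset (EuclideanSpace ℝ (Fin 3))) ∉ B ∧
        ({p2, q2} : Finset (EuclideanSpace ℝ (Fin 3))) ∉ B ∧
        ({u2, w2} : Finset (EuclideanSpace ℝ (Fin 3))) ∉ B) ∧
      ((p2 ≠ u2 ∧ p2 ≠ r2 ∧ p2 ≠ b2 ∧ u2 ≠ r2 ∧ u2 ≠ b2 ∧ r2 ≠ b2) ∧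
        (q2 ≠ w2 ∧ q2 ≠ r2 ∧ q2 ≠ a2 ∧ w2 ≠ r2 ∧ w2 ≠ a2 ∧ r2 ≠ a2) ∧
        (p2 ≠ n2 ∧ p2 ≠ m2 ∧ p2 ≠ q2 ∧ n2 ≠ m2 ∧ n2 ≠ q2 ∧ m2 ≠ q2) ∧
        (u2 ≠ a2 ∧ u2 ≠ b2 ∧ u2 ≠ w2 ∧ a2 ≠ b2 ∧ a2 ≠ w2 ∧ b2 ≠ w2) ∧ r2 ≠ c2) ∧
      (∀ y, ({p2, y} : Finset (EuclideanSpace ℝ (Fin 3))) ∈ B ↔ (y = a2 ∨ y = u2 ∨ y = c2 ∨ y = n2)) ∧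
      (∀ y, ({q2, y} : Finset (EuclideanSpace ℝ (Fin 3))) ∈ B ↔ (y = b2 ∨ y = w2 ∨ y = c2 ∨ y = m2))))
    {V3 : EuclideanSpace ℝ (Fin 3) → Prop} (hVa1 : V3 a1) (hVb1 : V3 b1) (hVc1 : V3 c1)
    (hVa2 : V3 a2) (hVb2 : V3 b2) (hVc2 : V3 c2) (hVp1 : ¬ V3 p1) (hVq1 : ¬ V3 q1)
    (hVp2 : ¬ V3 p2) (hVq2 : ¬ V3 q2)
    (hdisj : ∀ y, (y = a1 ∨ y = b1 ∨ y = c1) → ¬ (y = a2 ∨ y = b2 ∨ y = c2))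
    (hac1 : a1 ≠ c1) (hbc1 : b1 ≠ c1) (hac2 : a2 ≠ c2) (hbc2 : b2 ≠ c2)
    (hr1 : r1 = a2 ∨ r1 = b2 ∨ r1 = c2) (hr2 : r2 = a1 ∨ r2 = b1 ∨ r2 = c1) : False := by
  rcases hr1 with e | e | e
  · exact two_blocks_a hB hcard hdeg ha1 hb1 hc1 ha2 hb2 hc2 h1 h2 hVa1 hVb1 hVc1 hVa2 hVb2 hVc2 hVp1
      hVq1 hVq2 hdisj hac1 hbc1 hac2 hbc2 e
  · exact two_blocks_a hB hcard hdeg ha1 hb1 hc1 hb2 ha2 hc2 h1 (block_swap h2) hVa1 hVb1 hVc1 hVb2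
      hVa2 hVc2 hVp1 hVq1 hVp2
      (fun y hy h => hdisj y hy (by
        rcases h with h | h | h; exacts [Or.inr (Or.inl h), Or.inl h, Or.inr (Or.inr h)]))
      hac1 hbc1 hbc2 hac2 e
  · exact two_blocks_c hB hcard hdeg ha1 hb1 hc1 ha2 hb2 hc2 h1 h2 hVa1 hVb1 hVa2 hVb2 hVc2 hVp1 hVq1
      hdisj hac1 hbc1 hac2 hbc2 e hr2

end Setting

end Summit.AtomisticToContinuum.Crystallization.Theorems
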